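import Literature.Analysis.FluidPDE.UniqueContinuationCarleman
import Literature.Analysis.FluidPDE.BackwardHeatRegularityProofs
import HarnessLib

/-!
# Unique continuation across spatial boundaries, IV: the Gaussian decay of Lemma A.1

Analysis/FluidPDE proof file (theorems only) on the discharge path of the named fact
`Literature.Analysis.FluidPDE.ess_unique_continuation` (`NSLerayHopfProofs.lean`;
Escauriaza–Seregin–Šverák 2003, Thm. 4.1 = Seregin 2014, App. A.2, Thm. 2.4 / Lemma A.1).
We return from the rescaled variables of `UniqueContinuationCarleman.lean` to the original
ones and prove **Lemma A.1** (Seregin 2014, p. 210, (A.2.4)) for `C²` solutions of the backward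
heat inequality in a cylinder `]0, T[ × B(x₁, R)` centred at an arbitrary point `x₁`:
if `|∂ₜu + Δu| ≤ c₁(|u| + |∇u|)`, `|u| ≤ M`, and `(x₁, 0)` is a zero of infinite order
(`|u(x, t)| ≤ C_k(|x - x₁| + √t)^k` for all `k`, (A.2.3)), then
`|u(x, t)| ≤ K e^{-|x - x₁|²/8t}` whenever `0 < t ≤ γ min(T, 1)`, `|x - x₁| ≤ β₁ R` and
`β₂ t ≤ |x - x₁|²`, with `β₁, β₂, γ` depending only on `n, m, c₁` and `K` depending on the
solution. Ingredients: the parabolic dilation `v(s, y) = u(λ²s, x₁ + λy)`, `λ = √(2t)`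
(`UniqueContinuationRescale.lean`; (A.2.5)–(A.2.6)); the bound `A` on `|v| + |∇v|` over the
rescaled cylinder ((A.2.10)), obtained from `|u| ≤ M` and the interior gradient estimate
`Carleman.exists_sqrt_gradSq_le_of_backwardHeat` (`BackwardHeatInteriorGradient.lean`, which
replaces Remark A.2); the Carleman estimate `Carleman.exists_carleman_decay` ((A.2.8)–(A.2.17));
and the `L∞–L²` estimate (A.2.18), the discharged fact
`Carleman.seregin_backwardHeat_sup_le_L2_holds` (`BackwardHeatRegularityProofs.lean`).
The printed (A.2.4) has `e^{-|x|²/4t}` and `c₂(c₁) A₀(R, T)`; for the proof of Thm. 2.4 only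
some Gaussian decay with a solution-dependent constant is needed, which is what we state.

## References

* G. Seregin, *Lecture notes on regularity theory for the Navier–Stokes equations*, World
  Scientific 2014, App. A.2, Lemma A.1 with Remarks A.1–A.2, (A.2.4)–(A.2.18), pp. 210–212.
* L. Escauriaza, G. Seregin, V. Šverák, Russ. Math. Surveys 58:2 (2003) 211–250, §4,
  Lemma 4.2.
-/

noncomputable section

open MeasureTheory Set Function Filter Topology Metric
open scoped InnerProductSpace RealInnerProductSpace Nat

namespace Literature.Analysis.FluidPDE

namespace Carleman

set_option maxHeartbeats 800000 in
/-- **Lemma A.1 (Gaussian decay near a zero of infinite order)** (Seregin 2014, App. A.2,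
Lemma A.1, (A.2.4), for `C²` solutions and an arbitrary spatial centre `x₁`). For all `n, m`
and `c₁ ≥ 0` there are `β₁ ∈ (0, 1)`, `β₂ > 0`, `γ ∈ (0, 1/5]` such that: if
`u : ℝ × ℝⁿ → ℝᵐ` is `C²` on `]0, T[ × B(x₁, R)`, satisfies there
`|∂ₜu + Δu| ≤ c₁ (|u| + |∇u|)` and `|u| ≤ M`, and vanishes to infinite order at `(0, x₁)`,
`|u(t, x)| ≤ C_k (|x - x₁| + √t)^k` on the cylinder for every `k`, then there is `K` with
`|u(t, x)| ≤ K e^{-|x - x₁|²/(8t)}` for all `(t, x)` with `0 < t ≤ γT`, `t ≤ γ`,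
`|x - x₁| ≤ β₁R`, `β₂ t ≤ |x - x₁|²`. (Seregin: `0 < t ≤ γT`, `|x| ≤ β₁R`, `β₂t ≤ |x|²`,
`|u| ≤ c₂ A₀ e^{-|x|²/4t}`; the weaker exponent and the solution-dependent constant suffice
for Thm. 2.4.) [cite: Seregin2014, App. A.2 Lemma A.1 (A.2.4)] -/
theorem exists_gaussian_decay (n m : ℕ) {c₁ : ℝ} (hc₁ : 0 ≤ c₁) :
    ∃ β₁ β₂ γ : ℝ, 0 < β₁ ∧ β₁ < 1 ∧ 0 < β₂ ∧ 0 < γ ∧ γ ≤ 1 / 5 ∧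
    ∀ (u : ℝ × EuclideanSpace ℝ (Fin n) → EuclideanSpace ℝ (Fin m))
      (x₁ : EuclideanSpace ℝ (Fin n)) (R T M : ℝ), 0 < R → 0 < T → 0 ≤ M →
      ContDiffOn ℝ 2 u (Ioo 0 T ×ˢ ball x₁ R) →
      (∀ z ∈ Ioo 0 T ×ˢ ball x₁ R,
        ‖dt u z + lap u z‖ ≤ c₁ * (‖u z‖ + Real.sqrt (gradSq u z))) →
      (∀ z ∈ Ioo 0 T ×ˢ ball x₁ R, ‖u z‖ ≤ M) →
      (∀ k : ℕ, ∃ Ck : ℝ, ∀ z ∈ Ioo 0 T ×ˢ ball x₁ R,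
        ‖u z‖ ≤ Ck * (‖z.2 - x₁‖ + Real.sqrt z.1) ^ k) →
      ∃ K : ℝ, ∀ (t : ℝ) (x : EuclideanSpace ℝ (Fin n)), 0 < t → t ≤ γ * T → t ≤ γ →
        ‖x - x₁‖ ≤ β₁ * R → β₂ * t ≤ ‖x - x₁‖ ^ 2 →
        ‖u (t, x)‖ ≤ K * Real.exp (-(‖x - x₁‖ ^ 2 / (8 * t))) := by
  -- ## the constants
  obtain ⟨β, δ₀, ρ₀, K, hβ0, hβ28, hδ₀, hρ₀, hK0, hdecay⟩ :=
    exists_carleman_decay (E := EuclideanSpace ℝ (Fin n)) (F := EuclideanSpace ℝ (Fin m))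
  obtain ⟨c₉, hc₉, h218⟩ := seregin_backwardHeat_sup_le_L2_holds n m c₁
  obtain ⟨Cg, hCg, hgrad⟩ :=
    exists_sqrt_gradSq_le_of_backwardHeat (EuclideanSpace ℝ (Fin n)) (EuclideanSpace ℝ (Fin m))
  set μ : ℝ := Real.sqrt (2 * β) with hμ
  have hμ0 : 0 < μ := Real.sqrt_pos.2 (by linarith)
  have hμ2 : μ ^ 2 = 2 * β := Real.sq_sqrt (by linarith)
  have hμhalf : μ ≤ 1 / 2 := by
    rw [hμ, show (1 / 2 : ℝ) = Real.sqrt (1 / 4) by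
      rw [show (1 / 4 : ℝ) = (1 / 2) ^ 2 by norm_num, Real.sqrt_sq (by norm_num)]]
    exact Real.sqrt_le_sqrt (by linarith)
  set β₁ : ℝ := 3 * μ / 8 with hβ₁
  set β₂ : ℝ := β * ρ₀ ^ 2 with hβ₂
  set γ : ℝ := min (1 / 5) (δ₀ ^ 2 / (2 * c₁ ^ 2 + 1)) with hγ
  have hγ5 : γ ≤ 1 / 5 := min_le_left _ _
  have hγδ : γ ≤ δ₀ ^ 2 / (2 * c₁ ^ 2 + 1) := min_le_right _ _
  have hγ0 : 0 < γ := lt_min (by norm_num) (by positivity)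
  refine ⟨β₁, β₂, γ, by positivity, by rw [hβ₁]; linarith, by positivity, hγ0, hγ5, ?_⟩
  intro u x₁ R T M hR hT hM hu hineq huM hvan
  -- ## the gradient bound `G` on `]0, 3T/4] × B̄(x₁, 3R/4)` (interior estimate)
  set Oc : Set (ℝ × EuclideanSpace ℝ (Fin n)) := Ioo 0 T ×ˢ ball x₁ R with hOc
  have hOco : IsOpen Oc := isOpen_Ioo.prod isOpen_ball
  set r : ℝ := min (R / 8) (min (Real.sqrt T / 4) 1) with hr
  have hr0 : 0 < r := lt_min (by positivity) (lt_min (by positivity) one_pos)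
  have hrR : r ≤ R / 8 := min_le_left _ _
  have hrT : r ≤ Real.sqrt T / 4 := (min_le_right _ _).trans (min_le_left _ _)
  have hr1 : r ≤ 1 := (min_le_right _ _).trans (min_le_right _ _)
  have hrT2 : r ^ 2 ≤ T / 16 := by
    have h1 : r ^ 2 ≤ (Real.sqrt T / 4) ^ 2 := pow_le_pow_left₀ hr0.le hrT 2
    rw [div_pow, Real.sq_sqrt hT.le] at h1
    linarith
  set G : ℝ := Cg * (1 + c₁) * M / r with hG
  have hG0 : 0 ≤ G := by positivity
  have hGb : ∀ z ∈ Ioc 0 (3 * T / 4) ×ˢ closedBall x₁ (3 * R / 4), Real.sqrt (gradSq u z) ≤ G := by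
    rintro ⟨t₀, x₀⟩ ⟨⟨ht₀0, ht₀1⟩, hx₀⟩
    rw [mem_closedBall, dist_eq_norm] at hx₀
    have hsub : Icc (t₀ - t₀ / 2) (t₀ + r ^ 2) ×ˢ closedBall x₀ r ⊆ Oc := by
      rintro ⟨s, y⟩ ⟨⟨hs0, hs1⟩, hy⟩
      rw [mem_closedBall, dist_eq_norm] at hy
      refine ⟨⟨by linarith, by linarith⟩, ?_⟩
      rw [mem_ball, dist_eq_norm]
      calc ‖y - x₁‖ ≤ ‖y - x₀‖ + ‖x₀ - x₁‖ := norm_sub_le_norm_sub_add_norm_sub _ _ _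
        _ < R := by linarith
    have hsub' : Icc t₀ (t₀ + r ^ 2) ×ˢ closedBall x₀ r ⊆ Oc := fun z hz =>
      hsub ⟨⟨by linarith [hz.1.1], hz.1.2⟩, hz.2⟩
    exact hgrad hOco hr0 hr1 (by linarith) hc₁ hM hsub hu (fun z hz => hineq z (hsub' hz))
      fun z hz => huM z (hsub' hz)
  set A : ℝ := M + G with hA
  have hA0 : 0 ≤ A := by positivity
  have hMA : M ≤ A := by rw [hA]; linarith
  -- ## the claim
  refine ⟨Real.sqrt (c₉ * K) * A, fun t x ht htT htγ hxR hxt => ?_⟩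
  set d : EuclideanSpace ℝ (Fin n) := x - x₁ with hd
  have ht5 : t ≤ 1 / 5 := htγ.trans hγ5
  have htT5 : t ≤ T / 5 := htT.trans (by
    calc γ * T ≤ 1 / 5 * T := mul_le_mul_of_nonneg_right hγ5 hT.le
      _ = T / 5 := by ring)
  -- `λ = √(2t)`
  set lam : ℝ := Real.sqrt (2 * t) with hlam
  have hlam0 : 0 < lam := Real.sqrt_pos.2 (by linarith)
  have hlam2 : lam ^ 2 = 2 * t := Real.sq_sqrt (by linarith)
  have hlam1 : lam ≤ 1 := by
    rw [hlam, show (1 : ℝ) = Real.sqrt 1 from Real.sqrt_one.symm]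
    exact Real.sqrt_le_sqrt (by linarith)
  -- `δ = c₁ λ ≤ δ₀`
  have hδ : c₁ * lam ≤ δ₀ := by
    have h1 : (c₁ * lam) ^ 2 ≤ δ₀ ^ 2 := by
      rw [mul_pow, hlam2]
      have h2 : t * (2 * c₁ ^ 2 + 1) ≤ δ₀ ^ 2 := by
        rw [← le_div_iff₀ (by positivity)]; exact htγ.trans hγδ
      have h3 : 0 ≤ c₁ ^ 2 * t := by positivity
      nlinarith only [h2, h3, ht]
    exact (pow_le_pow_iff_left₀ (by positivity) hδ₀.le two_ne_zero).1 h1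
  have hβne : β ≠ 0 := hβ0.ne'
  have htne : t ≠ 0 := ht.ne'
  have hμne : μ ≠ 0 := hμ0.ne'
  have hlamne : lam ≠ 0 := hlam0.ne'
  -- ## the rescaled data: `ξ = d/μ`, `ρ = 2|ξ|/λ`, `y₀ = d/λ`
  set ξ : EuclideanSpace ℝ (Fin n) := μ⁻¹ • d with hξdef
  have hξ : ‖ξ‖ = ‖d‖ / μ := by
    rw [hξdef, norm_smul, norm_inv, Real.norm_of_nonneg hμ0.le, div_eq_inv_mul]
  set ρ : ℝ := 2 * ‖ξ‖ / lam with hρ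
  have hρnn : 0 ≤ ρ := by positivity
  have hlamρ : lam * ρ = 2 * ‖ξ‖ := by rw [hρ]; field_simp
  have hρsq : ρ ^ 2 = ‖d‖ ^ 2 / (β * t) := by
    rw [eq_div_iff (by positivity)]
    have e1 : ρ * lam * μ = 2 * ‖d‖ := by
      rw [mul_comm ρ lam, hlamρ, hξ]
      field_simp
    have e2 : ρ ^ 2 * (β * t) = (ρ * lam * μ) ^ 2 / 4 := by
      rw [mul_pow, mul_pow, hlam2, hμ2]; ring
    rw [e2, e1]
    ring
  have hρ₀ρ : ρ₀ ≤ ρ := by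
    have h1 : ρ₀ ^ 2 ≤ ρ ^ 2 := by
      rw [hρsq, le_div_iff₀ (by positivity)]
      calc ρ₀ ^ 2 * (β * t) = β * ρ₀ ^ 2 * t := by ring
        _ ≤ ‖d‖ ^ 2 := hxt
    exact (pow_le_pow_iff_left₀ (by linarith) hρnn two_ne_zero).1 h1
  have hρ4 : 4 ≤ ρ := hρ₀.trans hρ₀ρ
  set y₀ : EuclideanSpace ℝ (Fin n) := lam⁻¹ • d with hy₀def
  have hny₀ : ‖y₀‖ = ‖d‖ / lam := by
    rw [hy₀def, norm_smul, norm_inv, Real.norm_of_nonneg hlam0.le, div_eq_inv_mul]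
  have hy₀ρ : ‖y₀‖ ≤ Real.sqrt (2 * β) * ρ / 2 := by
    rw [← hμ, hny₀, hρ, hξ]
    apply le_of_eq
    field_simp
  have hy₀1 : ‖y₀‖ + 1 ≤ ρ := by
    have h1 : Real.sqrt (2 * β) * ρ / 2 ≤ (1 / 2) * ρ / 2 := by rw [← hμ]; gcongr
    linarith
  have hξR : 2 * ‖ξ‖ ≤ 3 * R / 4 := by
    have h1 : ‖d‖ / μ ≤ 3 * R / 8 := by
      rw [div_le_iff₀ hμ0]
      calc ‖d‖ ≤ 3 * μ / 8 * R := hxR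
        _ = 3 * R / 8 * μ := by ring
    rw [hξ]; linarith
  -- ## the rescaled function `v = u ∘ A` on `O = A⁻¹(]0,T[ × B(x₁,R))`
  set O : Set (ℝ × EuclideanSpace ℝ (Fin n)) :=
    (fun w : ℝ × EuclideanSpace ℝ (Fin n) => (lam ^ 2 * w.1, x₁ + lam • w.2)) ⁻¹' Oc with hOdef
  have hOo : IsOpen O := hOco.preimage (continuous_parabolicDilation lam x₁)
  set v : ℝ × EuclideanSpace ℝ (Fin n) → EuclideanSpace ℝ (Fin m) :=
    fun w => u (lam ^ 2 * w.1, x₁ + lam • w.2) with hvdef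
  have hvO : ContDiffOn ℝ 2 v O := contDiffOn_comp_parabolicDilation hu
  set Cyl : Set (ℝ × EuclideanSpace ℝ (Fin n)) :=
    Ioc (0 : ℝ) (7 / 4) ×ˢ closedBall (0 : EuclideanSpace ℝ (Fin n)) ρ with hCyl
  have himg : ∀ w ∈ Cyl,
      (lam ^ 2 * w.1, x₁ + lam • w.2) ∈ Ioc 0 (3 * T / 4) ×ˢ closedBall x₁ (3 * R / 4) := by
    intro w hw
    obtain ⟨⟨hw0, hw1⟩, hw2⟩ := hw
    rw [mem_closedBall, dist_zero_right] at hw2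
    refine ⟨⟨by rw [hlam2]; positivity, ?_⟩, ?_⟩
    · show lam ^ 2 * w.1 ≤ 3 * T / 4
      rw [hlam2]
      calc 2 * t * w.1 ≤ 2 * t * (7 / 4) := by gcongr
        _ ≤ 2 * (T / 5) * (7 / 4) := by gcongr
        _ ≤ 3 * T / 4 := by linarith
    · rw [mem_closedBall, dist_eq_norm, add_sub_cancel_left, norm_smul,
        Real.norm_of_nonneg hlam0.le]
      calc lam * ‖w.2‖ ≤ lam * ρ := mul_le_mul_of_nonneg_left hw2 hlam0.le
        _ = 2 * ‖ξ‖ := hlamρ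
        _ ≤ 3 * R / 4 := hξR
  have hinner_sub : Ioc 0 (3 * T / 4) ×ˢ closedBall x₁ (3 * R / 4) ⊆ Oc :=
    prod_mono (fun s hs => ⟨hs.1, by linarith [hs.2]⟩) (closedBall_subset_ball (by linarith))
  have hCylO : Cyl ⊆ O := fun w hw => hinner_sub (himg w hw)
  -- the inequality with the small constant `c₁ λ`
  have hineqv : ∀ w ∈ O, ‖dt v w + lap v w‖ ≤ c₁ * lam * (‖v w‖ + Real.sqrt (gradSq v w)) :=
    fun w hw => norm_dt_add_lap_comp_parabolicDilation_le hOco hu hc₁ hlam0 hlam1 hw (hineq _ hw)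
  -- the bounds `|v| ≤ A`, `|∇v|² ≤ A²` on the cylinder
  have hvA : ∀ w ∈ Cyl, ‖v w‖ ≤ A := fun w hw => (huM _ (hinner_sub (himg w hw))).trans hMA
  have hgA : ∀ w ∈ Cyl, gradSq v w ≤ A ^ 2 := by
    intro w hw
    have hz := himg w hw
    have hzO : (lam ^ 2 * w.1, x₁ + lam • w.2) ∈ Oc := hinner_sub hz
    have hud : DifferentiableAt ℝ u (lam ^ 2 * w.1, x₁ + lam • w.2) :=
      (hu.differentiableOn (by norm_num)).differentiableAt (hOco.mem_nhds hzO)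
    have e1 : gradSq v w = lam ^ 2 * gradSq u (lam ^ 2 * w.1, x₁ + lam • w.2) :=
      gradSq_comp_parabolicDilation hud
    rw [e1]
    have h1 : Real.sqrt (gradSq u (lam ^ 2 * w.1, x₁ + lam • w.2)) ≤ G := hGb _ hz
    have h2 : gradSq u (lam ^ 2 * w.1, x₁ + lam • w.2) ≤ G ^ 2 := by
      have h3 := pow_le_pow_left₀ (Real.sqrt_nonneg _) h1 2
      rwa [Real.sq_sqrt (gradSq_nonneg _ _)] at h3
    have h4 : G ^ 2 ≤ A ^ 2 := pow_le_pow_left₀ hG0 (by rw [hA]; linarith) 2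
    have h5 : lam ^ 2 ≤ 1 := pow_le_one₀ hlam0.le hlam1
    calc lam ^ 2 * gradSq u (lam ^ 2 * w.1, x₁ + lam • w.2) ≤ 1 * G ^ 2 :=
          mul_le_mul h5 h2 (gradSq_nonneg _ _) zero_le_one
      _ ≤ A ^ 2 := by rw [one_mul]; exact h4
  -- the infinite-order vanishing of `v` at the origin, (A.2.6)
  have hvan_v : ∀ k : ℕ, ∃ Ck : ℝ, ∀ w ∈ Cyl, ‖v w‖ ≤ Ck * (‖w.2‖ + Real.sqrt w.1) ^ k := by
    intro k
    obtain ⟨Ck, hCk⟩ := hvan k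
    refine ⟨max Ck 0, fun w hw => ?_⟩
    have hz := hinner_sub (himg w hw)
    have hw0 : 0 < w.1 := hw.1.1
    have h1 := hCk _ hz
    dsimp only at h1
    have h2 : ‖x₁ + lam • w.2 - x₁‖ + Real.sqrt (lam ^ 2 * w.1) = lam * (‖w.2‖ + Real.sqrt w.1) := by
      rw [add_sub_cancel_left, norm_smul, Real.norm_of_nonneg hlam0.le,
        Real.sqrt_mul' _ hw0.le, Real.sqrt_sq hlam0.le]
      ring
    rw [h2] at h1
    calc ‖v w‖ = ‖u (lam ^ 2 * w.1, x₁ + lam • w.2)‖ := rfl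
      _ ≤ Ck * (lam * (‖w.2‖ + Real.sqrt w.1)) ^ k := h1
      _ ≤ max Ck 0 * (lam * (‖w.2‖ + Real.sqrt w.1)) ^ k :=
          mul_le_mul_of_nonneg_right (le_max_left _ _) (by positivity)
      _ = max Ck 0 * (lam ^ k * (‖w.2‖ + Real.sqrt w.1) ^ k) := by rw [mul_pow]
      _ ≤ max Ck 0 * (1 * (‖w.2‖ + Real.sqrt w.1) ^ k) := by
          refine mul_le_mul_of_nonneg_left ?_ (le_max_right _ _)
          exact mul_le_mul_of_nonneg_right (pow_le_one₀ hlam0.le hlam1) (by positivity)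
      _ = max Ck 0 * (‖w.2‖ + Real.sqrt w.1) ^ k := by rw [one_mul]
  -- ## the Carleman decay estimate and (A.2.18)
  have hdec := hdecay v O ρ (c₁ * lam) A y₀ hOo hρ₀ρ (by positivity) hδ hy₀ρ hCylO hvO
    (fun w hw => hineqv w (hCylO hw)) hvA hgA hvan_v
  have hsub218 : Icc (1 / 2 : ℝ) 1 ×ˢ closedBall y₀ 1 ⊆ O :=
    (inner_closure_subset_cylinder hy₀1).trans hCylO
  have hineq218 : ∀ z ∈ O, ‖dt v z + lap v z‖ ≤ c₁ * (Real.sqrt (gradSq v z) + ‖v z‖) := by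
    intro z hz
    refine (hineqv z hz).trans ?_
    rw [add_comm (Real.sqrt _)]
    exact mul_le_mul_of_nonneg_right (mul_le_of_le_one_right hc₁ hlam1) (by positivity)
  have h218v := h218 y₀ v O hOo hsub218 hvO hineq218
  -- `v(1/2, y₀) = u(t, x)` and `βρ²/4 = |d|²/4t`
  have hvpt : v ((1 / 2 : ℝ), y₀) = u (t, x) := by
    show u (lam ^ 2 * (1 / 2), x₁ + lam • y₀) = u (t, x)
    refine congrArg u (Prod.ext ?_ ?_)
    · show lam ^ 2 * (1 / 2) = t
      rw [hlam2]; ring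
    · show x₁ + lam • y₀ = x
      rw [hy₀def, smul_smul, mul_inv_cancel₀ hlamne, one_smul, hd]
      abel
  have hexp : Real.exp (-(β / 4 * ρ ^ 2)) = Real.exp (-(‖d‖ ^ 2 / (4 * t))) := by
    congr 2
    rw [hρsq]
    field_simp
  have he2 : Real.exp (-(‖d‖ ^ 2 / (8 * t))) ^ 2 = Real.exp (-(‖d‖ ^ 2 / (4 * t))) := by
    rw [sq, ← Real.exp_add]
    congr 1
    ring
  have hsq : ‖u (t, x)‖ ^ 2 ≤ (Real.sqrt (c₉ * K) * A * Real.exp (-(‖d‖ ^ 2 / (8 * t)))) ^ 2 := by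
    have h1 : ‖u (t, x)‖ ^ 2 ≤ c₉ * (K * A ^ 2 * Real.exp (-(‖d‖ ^ 2 / (4 * t)))) := by
      rw [← hvpt, ← hexp]
      exact h218v.trans (mul_le_mul_of_nonneg_left hdec hc₉.le)
    have h2 : (Real.sqrt (c₉ * K) * A * Real.exp (-(‖d‖ ^ 2 / (8 * t)))) ^ 2 =
        c₉ * (K * A ^ 2 * Real.exp (-(‖d‖ ^ 2 / (4 * t)))) := by
      rw [mul_pow, mul_pow, Real.sq_sqrt (by positivity), he2]
      ring
    rw [h2]
    exact h1
  exact (pow_le_pow_iff_left₀ (norm_nonneg _) (by positivity) two_ne_zero).1 hsq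

end Carleman

end Literature.Analysis.FluidPDE
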